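import Literature.Barriers.CriticalPhenomena.SupercriticalSAWSpaceFillingBoxesRungs
import Literature.Probability.RandomPlanarGeometry.SquaredWalksFromRectangles
import HarnessLib

/-!
# Supercritical self-avoiding walks are space-filling (Duminil-Copin–Kozma–Yadin 2014):
# cycles through a given edge, and translating the polygons of `P_n` into a box (`|F| = 1`)

Second companion file of `SupercriticalSAWSpaceFillingBoxes.lean` towards the Claim in the
proof of Proposition 7 of H. Duminil-Copin, G. Kozma, A. Yadin, *Supercritical self-avoiding
walks are space-filling*, Ann. IHP Probab. Stat. 50 (2014) 315–326, arXiv:1110.3074, §3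
(objects in `SupercriticalSAWSpaceFillingBoxesRungs.lean`). Contents:

* walks (any simple graph): in a cycle through the edge `s(a, b)`, deleting that edge leaves a
  self-avoiding walk from `a` to `b` carrying the other edges
  (`exists_isPath_of_isCycle_of_mem_edges`, via Mathlib's `Walk.rotate`); a walk or cycle
  whose edges lie in `𝓔(R)` has its vertices in `R` (`support_subset_of_isCycle`);
* translations of `ℤ²` (the tree's `zdShiftIso`): the translate of a polygon is a polygon with
  as many edges (`isPolygon_shiftEdges`), inside the translated region
  (`shiftEdges_subset_edgesIn`), and the four cardinal edges of `[0,2n+1]²` go to the four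
  inner cardinal edges of the box (`innerCardinalEdge_mem_shiftEdges`); hence the base case
  of the Claim, "If the cardinality of `F` is 1, `Z_F(x) = Z_m(x)` by definition":
  `P_n + c_z ⊆ S_{{z}}` and `Z_n(x) ≤ Z_{{z}}(x)` for `x ≥ 0`
  (`shiftEdges_mem_familyPolygons_singleton`, `Zbox_le_familyPartition_singleton`).

Mathlib: `SimpleGraph.Walk.rotate`, `Walk.cons_isCycle_iff`, `Walk.IsCycle.map`; the tree's
`RectanglePair.isPath_append_of_inter` (`SquaredWalksFromRectangles.lean`) is used downstream.
-/

noncomputable section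

open SimpleGraph Literature.Probability.LatticeModels Literature.Probability.Percolation
  Literature.Probability.RandomPlanarGeometry.SAW

namespace Literature.Barriers.CriticalPhenomena

namespace SupercriticalSAW

section Walks

variable {V : Type*} {G : SimpleGraph V}

/-- A self-avoiding walk from `a` using the edge `s(a, b)` starts with it. [folklore] -/
theorem exists_eq_cons_of_isPath_of_mem_edges {a v b : V} {q : G.Walk a v} (hq : q.IsPath)
    (he : s(a, b) ∈ q.edges) : ∃ (h : G.Adj a b) (r : G.Walk b v), q = Walk.cons h r := by
  cases q with
  | nil => simp at he
  | cons h r =>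
    rename_i b'
    rw [Walk.cons_isPath_iff] at hq
    rw [Walk.edges_cons, List.mem_cons] at he
    rcases he with he | he
    · have hb : b' = b := (Sym2.congr_right.1 he.symm)
      subst hb
      exact ⟨h, r, rfl⟩
    · exact absurd (r.fst_mem_support_of_mem_edges he) hq.2

/-- In a cycle based at `a` through the edge `s(a, b)`, deleting that edge leaves a self-avoiding
walk from `a` to `b` with the remaining edges. [folklore] -/
theorem exists_isPath_of_isCycle_of_mem_edges_aux [DecidableEq V] {a b : V} {c : G.Walk a a}
    (hc : c.IsCycle) (he : s(a, b) ∈ c.edges) :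
    ∃ p : G.Walk a b, p.IsPath ∧ s(a, b) ∉ p.edges ∧
      p.edges.toFinset = c.edges.toFinset.erase s(a, b) ∧ p.length + 1 = c.length ∧
      ∀ w ∈ p.support, w ∈ c.support := by
  cases c with
  | nil => simp at he
  | cons h t =>
    rename_i v
    rw [Walk.cons_isCycle_iff] at hc
    rw [Walk.edges_cons, List.mem_cons] at he
    by_cases hbv : s(a, b) = s(a, v)
    · have hb : v = b := (Sym2.congr_right.1 hbv.symm)
      subst hb
      refine ⟨t.reverse, hc.1.reverse, ?_, ?_, ?_, ?_⟩
      · rw [Walk.edges_reverse, List.mem_reverse]; exact hc.2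
      · rw [Walk.edges_reverse, List.toFinset_reverse, Walk.edges_cons, List.toFinset_cons,
          Finset.erase_insert]
        rw [List.mem_toFinset]; exact hc.2
      · rw [Walk.length_reverse, Walk.length_cons]
      · intro w hw
        rw [Walk.support_reverse, List.mem_reverse] at hw
        rw [Walk.support_cons]
        exact List.mem_cons_of_mem _ hw
    · have he' : s(a, b) ∈ t.edges := he.resolve_left hbv
      have hq : t.reverse.IsPath := hc.1.reverse
      have heq : s(a, b) ∈ t.reverse.edges := by
        rw [Walk.edges_reverse, List.mem_reverse]; exact he'
      obtain ⟨h', r, hr⟩ := exists_eq_cons_of_isPath_of_mem_edges hq heq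
      have hr' : r.IsPath ∧ a ∉ r.support := by
        rw [hr, Walk.cons_isPath_iff] at hq; exact hq
      have hab_r : s(a, b) ∉ r.edges := fun h => hr'.2 (r.fst_mem_support_of_mem_edges h)
      have ht : t = (Walk.cons h' r).reverse := by
        rw [← hr, Walk.reverse_reverse]
      refine ⟨Walk.cons h r.reverse, ?_, ?_, ?_, ?_, ?_⟩
      · rw [Walk.cons_isPath_iff]
        refine ⟨hr'.1.reverse, ?_⟩
        rw [Walk.support_reverse, List.mem_reverse]; exact hr'.2
      · rw [Walk.edges_cons, List.mem_cons, Walk.edges_reverse, List.mem_reverse]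
        rintro (h1 | h1)
        · exact hbv h1
        · exact hab_r h1
      · have h1 : (Walk.cons h r.reverse).edges.toFinset = insert s(a, v) r.edges.toFinset := by
          rw [Walk.edges_cons, List.toFinset_cons, Walk.edges_reverse, List.toFinset_reverse]
        have h2 : (Walk.cons h t).edges.toFinset =
            insert s(a, v) (insert s(a, b) r.edges.toFinset) := by
          rw [Walk.edges_cons, List.toFinset_cons, ht, Walk.edges_reverse, List.toFinset_reverse,
            Walk.edges_cons, List.toFinset_cons]
        rw [h1, h2, Finset.erase_insert_of_ne (Ne.symm hbv), Finset.erase_insert]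
        rw [List.mem_toFinset]; exact hab_r
      · rw [ht, Walk.length_cons, Walk.length_reverse, Walk.length_cons, Walk.length_reverse,
          Walk.length_cons]
      · intro w hw
        rw [Walk.support_cons, List.mem_cons, Walk.support_reverse, List.mem_reverse] at hw
        rw [ht, Walk.support_cons, Walk.support_reverse, List.mem_cons, List.mem_reverse,
          Walk.support_cons, List.mem_cons]
        tauto

/-- In a cycle through the edge `s(a, b)`, deleting that edge leaves a self-avoiding walk from `a`
to `b` carrying the remaining edges (one fewer), inside the support of the cycle. [folklore] -/
theorem exists_isPath_of_isCycle_of_mem_edges [DecidableEq V] {u a b : V} {c : G.Walk u u}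
    (hc : c.IsCycle) (he : s(a, b) ∈ c.edges) :
    ∃ p : G.Walk a b, p.IsPath ∧ s(a, b) ∉ p.edges ∧
      p.edges.toFinset = c.edges.toFinset.erase s(a, b) ∧ p.length + 1 = c.length ∧
      ∀ w ∈ p.support, w ∈ c.support := by
  have ha : a ∈ c.support := c.fst_mem_support_of_mem_edges he
  have hc' : (c.rotate a ha).IsCycle := hc.rotate ha
  have he' : s(a, b) ∈ (c.rotate a ha).edges := (c.rotate_edges a ha).mem_iff.2 he
  obtain ⟨p, hp, hpe, hpE, hlen, hsupp⟩ := exists_isPath_of_isCycle_of_mem_edges_aux hc' he'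
  refine ⟨p, hp, hpe, ?_, ?_, fun w hw => (Walk.mem_support_rotate_iff c a ha).1 (hsupp w hw)⟩
  · rw [hpE, List.toFinset_eq_of_perm _ _ (c.rotate_edges a ha).perm]
  · rw [hlen, Walk.length_rotate]

/-- A walk whose edges have all their endpoints in `R` and which starts in `R` stays in `R`.
[folklore] -/
theorem support_subset_of_edges_subset [DecidableEq V] [G.LocallyFinite] {R : Finset V} {u v : V}
    (p : G.Walk u v) (hu : u ∈ R) (hp : ∀ e ∈ p.edges, e ∈ edgesIn G R) :
    ∀ w ∈ p.support, w ∈ R := by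
  induction p with
  | nil => intro w hw; rw [Walk.support_nil, List.mem_singleton] at hw; exact hw ▸ hu
  | cons h q ih =>
    rename_i a b _
    intro w hw
    rw [Walk.support_cons, List.mem_cons] at hw
    rcases hw with rfl | hw
    · exact hu
    · refine ih ?_ (fun e he => hp e ?_) w hw
      · have h1 := hp s(a, b) (by rw [Walk.edges_cons]; exact List.mem_cons_self)
        exact (mem_edgesIn_iff.1 h1).2 b (Sym2.mem_mk_right a b)
      · rw [Walk.edges_cons]; exact List.mem_cons_of_mem _ he

/-- Every vertex of a cycle whose edges have all their endpoints in `R` lies in `R`. [folklore] -/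
theorem support_subset_of_isCycle [DecidableEq V] [G.LocallyFinite] {R : Finset V} {u : V}
    {c : G.Walk u u} (hc : c.IsCycle) (hE : ∀ e ∈ c.edges, e ∈ edgesIn G R) :
    ∀ w ∈ c.support, w ∈ R := by
  cases c with
  | nil => exact absurd hc Walk.not_isCycle_nil
  | cons h q =>
    rename_i b
    refine support_subset_of_edges_subset _ ?_ hE
    have h1 := hE s(u, b) (by rw [Walk.edges_cons]; exact List.mem_cons_self)
    exact (mem_edgesIn_iff.1 h1).2 u (Sym2.mem_mk_left u b)

end Walks

/-! ### Translating the polygons of `P_n` into an inner box -/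

/-- A translate of a polygon is a polygon. [folklore] -/
theorem isPolygon_shiftEdges {E : Finset (Sym2 (Site 2))} (hE : IsPolygon (zdGraph 2) E)
    (c : Site 2) : IsPolygon (zdGraph 2) (shiftEdges c E) := by
  classical
  obtain ⟨u, w, hw, rfl⟩ := hE
  refine ⟨_, w.map (zdShiftIso c).toHom, hw.map (RelIso.injective (zdShiftIso c)), ?_⟩
  rw [Walk.edges_map]
  ext e
  simp only [List.mem_toFinset, List.mem_map, shiftEdges, Finset.mem_image]
  rfl

/-- The edges of a translate have their endpoints in the translate. [folklore] -/
theorem shiftEdges_subset_edgesIn {E : Finset (Sym2 (Site 2))} {R : Finset (Site 2)}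
    (hE : E ⊆ edgesIn (zdGraph 2) R) (c : Site 2) :
    shiftEdges c E ⊆ edgesIn (zdGraph 2) (R.image fun v => c + v) := by
  intro e he
  obtain ⟨e', he', rfl⟩ := mem_shiftEdges_iff.1 he
  have h' := mem_edgesIn_iff.1 (hE he')
  rw [mem_edgesIn_iff]
  constructor
  · induction e' using Sym2.ind with
    | _ a b =>
      rw [Sym2.map_mk, SimpleGraph.mem_edgeSet]
      exact (zdGraph_adj_shift_iff c a b).2 h'.1
  · intro x hx
    obtain ⟨y, hy, rfl⟩ := Sym2.mem_map.1 hx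
    rw [add_comm]
    exact Finset.mem_image_of_mem _ (h'.2 y hy)

/-- The four cardinal edges of `[0,2n+1]²` translate onto the four inner cardinal edges of the
box with inner corner `c`. [cite: DuminilCopinKozmaYadin2014, §2 (definition of P_m) and §3 (cardinal edges)] -/
theorem innerCardinalEdge_mem_shiftEdges {n g : ℕ} {z : Site 2} {E : Finset (Sym2 (Site 2))}
    (hE : cardinalEdges n ⊆ E) (j : Fin 2) (t : Bool) :
    innerCardinalEdge n g z j t ∈ shiftEdges (innerCorner n g z) E := by
  rw [mem_shiftEdges_iff]
  have key : ∀ a b a' b' : ℤ, Sym2.map (fun v => v + innerCorner n g z) s(![a, b], ![a', b']) =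
      s(innerCorner n g z + ![a, b], innerCorner n g z + ![a', b']) := by
    intro a b a' b'
    rw [Sym2.map_mk, add_comm _ (innerCorner n g z), add_comm _ (innerCorner n g z)]
  have h10 : (1 : Fin 2) + 1 = 0 := rfl
  fin_cases j <;> cases t
  · -- left edge `[(0,n),(0,n+1)]`
    refine ⟨_, hE (by simp [cardinalEdges]), (key 0 n 0 (n + 1)).trans ?_⟩
    simp only [innerCardinalEdge]
    refine congrArg₂ Sym2.mk ?_ ?_ <;> (funext k; fin_cases k <;> simp [add_assoc])
  · -- right edge `[(2n+1,n),(2n+1,n+1)]`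
    refine ⟨_, hE (by simp [cardinalEdges]), (key (2 * n + 1) n (2 * n + 1) (n + 1)).trans ?_⟩
    simp only [innerCardinalEdge]
    refine congrArg₂ Sym2.mk ?_ ?_ <;> (funext k; fin_cases k <;> simp [add_assoc])
  · -- bottom edge `[(n,0),(n+1,0)]`
    refine ⟨_, hE (by simp [cardinalEdges]), (key n 0 (n + 1) 0).trans ?_⟩
    simp only [innerCardinalEdge]
    refine congrArg₂ Sym2.mk ?_ ?_ <;> (funext k; fin_cases k <;> simp [h10, add_assoc])
  · -- top edge `[(n,2n+1),(n+1,2n+1)]`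
    refine ⟨_, hE (by simp [cardinalEdges]), (key n (2 * n + 1) (n + 1) (2 * n + 1)).trans ?_⟩
    simp only [innerCardinalEdge]
    refine congrArg₂ Sym2.mk ?_ ?_ <;> (funext k; fin_cases k <;> simp [h10, add_assoc])

/-- **`|F| = 1`: "Z_F(x) = Z_m(x) by definition".** The translate by the inner corner of `B(z)`
of a polygon of `P_n` is a polygon of `S_{{z}}` (inside the inner box, through the four inner
cardinal edges). [cite: DuminilCopinKozmaYadin2014, §3 (proof of Proposition 7, Claim, |F| = 1)] -/
theorem shiftEdges_mem_familyPolygons_singleton {n g : ℕ} (z : Site 2) {E : Finset (Sym2 (Site 2))}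
    (hE : E ∈ facePolygons n) : shiftEdges (innerCorner n g z) E ∈ familyPolygons n g {z} := by
  rw [mem_facePolygons_iff] at hE
  rw [mem_familyPolygons_iff]
  refine ⟨(shiftEdges_subset_edgesIn hE.1 _).trans
      (edgesIn_subset_of_subset (innerBox_subset_polygonRegion (Finset.mem_singleton_self z))),
    isPolygon_shiftEdges hE.2.1 _, fun z' hz' j t _ => ?_⟩
  rw [Finset.mem_singleton] at hz'
  subst hz'
  exact innerCardinalEdge_mem_shiftEdges hE.2.2 j t

/-- `Z_n(x) ≤ Z_{{z}}(x)` for `x ≥ 0`. [cite: DuminilCopinKozmaYadin2014, §3 (proof of Proposition 7, Claim, |F| = 1)] -/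
theorem Zbox_le_familyPartition_singleton (n g : ℕ) (z : Site 2) {x : ℝ} (hx : 0 ≤ x) :
    Zbox n x ≤ familyPartition n g {z} x := by
  rw [Zbox, familyPartition]
  calc ∑ E ∈ facePolygons n, x ^ E.card
      = ∑ E ∈ facePolygons n, x ^ (shiftEdges (innerCorner n g z) E).card := by
        simp only [card_shiftEdges]
    _ = ∑ E ∈ (facePolygons n).image (shiftEdges (innerCorner n g z)), x ^ E.card := by
        rw [Finset.sum_image fun _ _ _ _ h => shiftEdges_injective _ h]
    _ ≤ ∑ E ∈ familyPolygons n g {z}, x ^ E.card := by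
        refine Finset.sum_le_sum_of_subset_of_nonneg ?_ fun _ _ _ => pow_nonneg hx _
        intro E hE
        obtain ⟨E', hE', rfl⟩ := Finset.mem_image.1 hE
        exact shiftEdges_mem_familyPolygons_singleton z hE'

/-- The translate of a polygon of `P_n` into the inner box of `B(z)`: a polygon inside the inner
box through its four inner cardinal edges. [cite: DuminilCopinKozmaYadin2014, §3 (proof of the Claim, S_B)] -/
theorem shiftEdges_facePolygons {n g : ℕ} (z : Site 2) {E' : Finset (Sym2 (Site 2))}
    (hE' : E' ∈ facePolygons n) :
    IsPolygon (zdGraph 2) (shiftEdges (innerCorner n g z) E') ∧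
      shiftEdges (innerCorner n g z) E' ⊆ edgesIn (zdGraph 2) (innerBox n g z) ∧
      ∀ (j : Fin 2) (t : Bool),
        innerCardinalEdge n g z j t ∈ shiftEdges (innerCorner n g z) E' := by
  rw [mem_facePolygons_iff] at hE'
  exact ⟨isPolygon_shiftEdges hE'.2.1 _, shiftEdges_subset_edgesIn hE'.1 _,
    innerCardinalEdge_mem_shiftEdges hE'.2.2⟩


end SupercriticalSAW

end Literature.Barriers.CriticalPhenomena
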